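import Mathlib.Algebra.FiveLemma
import Mathlib.Algebra.Homology.DerivedCategory.Ext.ExactSequences
import Mathlib.Algebra.Homology.DerivedCategory.Ext.EnoughInjectives
import Mathlib.CategoryTheory.Preadditive.Injective.Basic
import Mathlib.CategoryTheory.Abelian.GrothendieckAxioms.Basic
import HarnessLib

/-!
# `Ext(X, –)` commutes with products when products of epimorphisms are epimorphisms

Let `C` be an abelian category with enough injectives and `ι`-indexed products, and suppose
that `ι`-indexed products of epimorphisms are epimorphisms (equivalently: `ι`-indexed products are
exact, Grothendieck's axiom AB4* for the index type `ι`, products being left exact in any case).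
Then for all objects `X`, all families `(Fᵢ)_{i ∈ ι}` and all `n` the comparison map

`Extⁿ(X, ∏ᵢ Fᵢ) → ∏ᵢ Extⁿ(X, Fᵢ)`, `e ↦ (prᵢ ∘ e)ᵢ`

(`Ext.piComparison`) is bijective (`Ext.piComparison_bijective`). The proof is dimension
shifting: for `n = 0` this is the universal property of the product; for `n + 1`, choose injective
presentations `0 → Fᵢ → Iᵢ → Qᵢ → 0`; their product `0 → ∏ Fᵢ → ∏ Iᵢ → ∏ Qᵢ → 0` is short exact by
the hypothesis (`shortExact_piMap`), `∏ Iᵢ` is injective, and the four lemma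
(`AddMonoidHom.bijective_of_surjective_of_bijective_of_right_exact`) applied to the ladder formed by
the long exact `Ext(X, –)`-sequences (Mathlib `Ext.covariant_sequence_exact₃'`,
`Ext.covariant_sequence_exact₁`, naturality of the connecting class
`ShortExact.extClass_naturality`) concludes. This is the standard argument that in an abelian
category with exact products "the product computes the derived product", so that
`RHom(X, ∏ Fᵢ) = ∏ RHom(X, Fᵢ)` (Bhatt–Scholze, *The pro-étale topology for schemes*, proofs of
Prop. 3.1.10 and Lemma 3.3.2; for modules: Weibel, *An introduction to homological algebra*,
Prop. 3.3.4).

## References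

* B. Bhatt, P. Scholze, *The pro-étale topology for schemes*, Astérisque 369 (2015), Prop. 3.1.9,
  Prop. 3.1.10 (proof). [BhattScholze2015]

## Design notes

* Pure homological algebra for an arbitrary abelian `C` with `HasExt.{w}`; the hypothesis is the
  epimorphism half of AB4* for the one index type `ι` only (the form proved for the pro-étale
  topos, where it follows from Bhatt–Scholze Prop. 3.1.9 / Ex. 3.1.7); it is implied by Mathlib's
  class `HasExactLimitsOfShape (Discrete ι) C` (`epi_piMap_of_hasExactLimitsOfShape`,
  `Ext.piComparison_bijective_of_hasExactLimitsOfShape`), so `AB4Star`/`CountableAB4Star`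
  categories get the statement by instance.
* Products of additive maps are Mathlib's `AddMonoidHom.piMap` (surjectivity:
  `Function.Surjective.piMap`); only their exactness (`exact_piMap`) is added here.
* Mathlib searches: `Ext.biproductAddEquiv`, `Ext.addEquivBiproduct` (finite biproducts only),
  `Functor.mapExt_bijective_of_preservesInjectiveObjects` (the dimension-shifting pattern reused
  here), `HasExactLimitsOfShape`, `AddMonoidHom.piMap`; no statement about `Ext` and infinite
  products. Nothing restated.
-/

universe w v u t

namespace Literature.Algebra.Homology

open CategoryTheory CategoryTheory.Limits CategoryTheory.Abelian

/-! ### Products of exact sequences of abelian groups (elementary) -/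

section AddMonoidHom

variable {ι : Type t} {M N P : ι → Type*} [∀ i, AddCommGroup (M i)] [∀ i, AddCommGroup (N i)]
  [∀ i, AddCommGroup (P i)]

/-- A product of exact pairs of additive maps is exact (products are exact in abelian groups;
the maps are Mathlib's `AddMonoidHom.piMap`). [folklore] -/
theorem exact_piMap {φ : ∀ i, M i →+ N i} {ψ : ∀ i, N i →+ P i}
    (h : ∀ i, Function.Exact (φ i) (ψ i)) :
    Function.Exact (AddMonoidHom.piMap φ) (AddMonoidHom.piMap ψ) := by
  intro y
  constructor
  · intro hy
    have hy' : ∀ i, y i ∈ Set.range (φ i) := fun i => (h i (y i)).1 (congr_fun hy i)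
    choose x hx using hy'
    exact ⟨x, funext fun i => by simp [hx]⟩
  · rintro ⟨x, rfl⟩
    funext i
    simp [(h i).apply_apply_eq_zero]

end AddMonoidHom

variable {C : Type u} [Category.{v} C] [Abelian C]

/-! ### Products of short exact sequences -/

section ShortExact

variable {ι : Type t} {S : ι → ShortComplex C} [HasProduct fun i => (S i).X₁]
  [HasProduct fun i => (S i).X₂] [HasProduct fun i => (S i).X₃]

variable (S) in
/-- The product `∏ Sᵢ.X₁ → ∏ Sᵢ.X₂ → ∏ Sᵢ.X₃` of a family of short complexes. [folklore] -/
noncomputable def piShortComplex : ShortComplex C :=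
  ShortComplex.mk (Limits.Pi.map fun i => (S i).f) (Limits.Pi.map fun i => (S i).g)
    (Pi.hom_ext _ _ fun i => by simp)

/-- The projections `∏ S → Sᵢ`. [folklore] -/
noncomputable def piShortComplexπ (i : ι) : piShortComplex S ⟶ S i where
  τ₁ := Pi.π _ i
  τ₂ := Pi.π _ i
  τ₃ := Pi.π _ i
  comm₁₂ := (Pi.map_π (fun i => (S i).f) i).symm
  comm₂₃ := (Pi.map_π (fun i => (S i).g) i).symm

/-- **A product of short exact sequences is short exact as soon as the product of the
epimorphisms is an epimorphism**: the product of the monomorphisms is a monomorphism and is the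
kernel of the product of the epimorphisms (limits commute with limits). [folklore] -/
theorem shortExact_piShortComplex (hS : ∀ i, (S i).ShortExact)
    [Epi (Limits.Pi.map fun i => (S i).g)] : (piShortComplex S).ShortExact := by
  haveI : ∀ i, Mono (S i).f := fun i => (hS i).mono_f
  haveI : Mono (piShortComplex S).f := inferInstanceAs (Mono (Limits.Pi.map fun i => (S i).f))
  haveI : Epi (piShortComplex S).g := ‹Epi (Limits.Pi.map fun i => (S i).g)›
  refine ShortComplex.ShortExact.mk' (ShortComplex.exact_of_f_is_kernel _ ?_) inferInstance
    inferInstance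
  refine KernelFork.IsLimit.ofι' _ _ fun {A} k hk => ?_
  have hk' : ∀ i, (k ≫ Pi.π _ i) ≫ (S i).g = 0 := fun i => by
    have e : (k ≫ (piShortComplex S).g) ≫ Pi.π (fun i => (S i).X₃) i = 0 := by
      rw [hk, zero_comp]
    simpa only [piShortComplex, Category.assoc, Pi.map_π] using e
  refine ⟨Pi.lift fun i => (hS i).exact.lift (k ≫ Pi.π _ i) (hk' i), Pi.hom_ext _ _ fun i => ?_⟩
  simp only [piShortComplex, Category.assoc, Pi.map_π]
  rw [Pi.lift_π_assoc, ShortComplex.Exact.lift_f]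

end ShortExact

variable [HasExt.{w} C]

section ExtClass

variable {ι : Type t} {S : ι → ShortComplex C} [HasProduct fun i => (S i).X₁]
  [HasProduct fun i => (S i).X₂] [HasProduct fun i => (S i).X₃]

/-- Naturality of the connecting classes along the projections `∏ S → Sᵢ`. [folklore] -/
theorem extClass_piShortComplex_comp_mk₀_π (hS : ∀ i, (S i).ShortExact)
    [Epi (Limits.Pi.map fun i => (S i).g)] (i : ι) :
    (shortExact_piShortComplex hS).extClass.comp (Ext.mk₀ (Pi.π (fun i => (S i).X₁) i))
        (add_zero 1) =
      (Ext.mk₀ (Pi.π (fun i => (S i).X₃) i)).comp (hS i).extClass (zero_add 1) :=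
  (shortExact_piShortComplex hS).extClass_naturality (hS i) (piShortComplexπ i)

end ExtClass

/-! ### The comparison map -/

section Comparison

variable {ι : Type t} (X : C) (F : ι → C) [HasProduct F]

/-- **The comparison map `Extⁿ(X, ∏ᵢ Fᵢ) → ∏ᵢ Extⁿ(X, Fᵢ)`**, `e ↦ (e · prᵢ)ᵢ` (postcomposition
with the classes of the projections). [folklore] -/
noncomputable def Ext.piComparison (n : ℕ) : Ext.{w} X (∏ᶜ F) n →+ ∀ i, Ext.{w} X (F i) n :=
  AddMonoidHom.pi fun i => (Ext.mk₀ (Pi.π F i)).postcomp X (add_zero n)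

/-- Components of the comparison map. [folklore] -/
@[simp] theorem Ext.piComparison_apply (n : ℕ) (e : Ext X (∏ᶜ F) n) (i : ι) :
    Ext.piComparison X F n e i = e.comp (Ext.mk₀ (Pi.π F i)) (add_zero n) := rfl

/-- In degree `0` the comparison map is bijective: `Ext⁰ = Hom` (Mathlib `Ext.mk₀_bijective`) and
the universal property of the product. [folklore] -/
theorem Ext.piComparison_bijective_zero : Function.Bijective (Ext.piComparison X F 0) := by
  constructor
  · intro e₁ e₂ h
    obtain ⟨g₁, rfl⟩ := (Ext.mk₀_bijective _ _).2 e₁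
    obtain ⟨g₂, rfl⟩ := (Ext.mk₀_bijective _ _).2 e₂
    have hg : g₁ = g₂ := by
      refine Pi.hom_ext _ _ fun i => (Ext.mk₀_bijective _ _).1 ?_
      have hi := congr_fun h i
      simpa only [Ext.piComparison_apply, Ext.mk₀_comp_mk₀] using hi
    rw [hg]
  · intro y
    choose g hg using fun i => (Ext.mk₀_bijective _ _).2 (y i)
    refine ⟨Ext.mk₀ (Pi.lift g), funext fun i => ?_⟩
    simp only [Ext.piComparison_apply, Ext.mk₀_comp_mk₀, Pi.lift_π, hg]

variable {X F} in
/-- Naturality of the comparison map in the family: for `pᵢ : Fᵢ → Gᵢ`,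
`prᵢ ∘ (∏ p)_* = (pᵢ)_* ∘ prᵢ`. [folklore] -/
theorem Ext.piComparison_comp_mk₀_piMap {G : ι → C} [HasProduct G] (p : ∀ i, F i ⟶ G i) (n : ℕ)
    (e : Ext X (∏ᶜ F) n) (i : ι) :
    Ext.piComparison X G n (e.comp (Ext.mk₀ (Limits.Pi.map p)) (add_zero n)) i =
      (Ext.piComparison X F n e i).comp (Ext.mk₀ (p i)) (add_zero n) := by
  simp only [Ext.piComparison_apply, Ext.comp_assoc_of_third_deg_zero, Ext.mk₀_comp_mk₀,
    Pi.map_π]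

end Comparison

/-! ### Dimension shifting -/

section Main

variable {ι : Type t} [HasLimitsOfShape (Discrete ι) C] [EnoughInjectives C]

/-- **`Ext(X, –)` commutes with products when products of epimorphisms are epimorphisms.** In an
abelian category `C` with enough injectives and `ι`-indexed products in which every `ι`-indexed
product of epimorphisms is an epimorphism, the comparison map
`Extⁿ(X, ∏ᵢ Fᵢ) → ∏ᵢ Extⁿ(X, Fᵢ)` is bijective for all `X`, `(Fᵢ)`, `n`. Dimension shifting along
injective presentations `0 → Fᵢ → Iᵢ → Qᵢ → 0` (whose product is again an injective presentation
by the hypothesis) and the four lemma; the formal content of "the product `∏ₙ Fₙ` computes the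
derived product" in a topos with exact countable products (Bhatt–Scholze Prop. 3.1.9, proof of
Prop. 3.1.10). [cite: BhattScholze2015, Prop. 3.1.10 (proof)] -/
theorem Ext.piComparison_bijective
    (hepi : ∀ (A B : ι → C) (p : ∀ i, A i ⟶ B i), (∀ i, Epi (p i)) → Epi (Limits.Pi.map p))
    (X : C) (F : ι → C) (n : ℕ) : Function.Bijective (Ext.piComparison X F n) := by
  induction n generalizing F with
  | zero => exact Ext.piComparison_bijective_zero X F
  | succ n hn =>
    let I : ∀ i, InjectivePresentation (F i) := fun i => Classical.arbitrary _
    let S : ι → ShortComplex C := fun i => ShortComplex.mk _ _ (cokernel.condition (I i).f)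
    have hS : ∀ i, (S i).ShortExact := fun i => { exact := ShortComplex.exact_cokernel (I i).f }
    haveI : Epi (Limits.Pi.map fun i => (S i).g) := hepi _ _ _ fun i => (hS i).epi_g
    have hT : (piShortComplex S).ShortExact := shortExact_piShortComplex hS
    haveI : ∀ i, Injective (S i).X₂ := fun i => (I i).injective
    haveI : Injective (piShortComplex S).X₂ :=
      inferInstanceAs (Injective (∏ᶜ fun i => (S i).X₂))
    -- the rungs of the ladder commute
    have hc₁ : (AddMonoidHom.piMap fun i => (Ext.mk₀ (S i).g).postcomp X (add_zero n)).comp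
        (Ext.piComparison X (fun i => (S i).X₂) n) =
        (Ext.piComparison X (fun i => (S i).X₃) n).comp
          ((Ext.mk₀ (piShortComplex S).g).postcomp X (add_zero n)) := by
      ext e i
      exact (Ext.piComparison_comp_mk₀_piMap (fun i => (S i).g) n e i).symm
    have hc₂ : (AddMonoidHom.piMap fun i => (hS i).extClass.postcomp X (rfl : n + 1 = n + 1)).comp
        (Ext.piComparison X (fun i => (S i).X₃) n) =
        (Ext.piComparison X (fun i => (S i).X₁) (n + 1)).comp
          (hT.extClass.postcomp X (rfl : n + 1 = n + 1)) := by
      ext e i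
      change (e.comp (Ext.mk₀ (Pi.π _ i)) (add_zero n)).comp (hS i).extClass rfl =
        (e.comp hT.extClass rfl).comp (Ext.mk₀ (Pi.π _ i)) (add_zero _)
      rw [Ext.comp_assoc_of_second_deg_zero, Ext.comp_assoc_of_third_deg_zero]
      congr 1
      exact (extClass_piShortComplex_comp_mk₀_π hS i).symm
    -- exactness of the two rows
    have hf₁ := (ShortComplex.ab_exact_iff_function_exact _).mp
      (Ext.covariant_sequence_exact₃' X hT n (n + 1) rfl)
    have hg₁ : Function.Exact
        (AddMonoidHom.piMap fun i => (Ext.mk₀ (S i).g).postcomp X (add_zero n))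
        (AddMonoidHom.piMap fun i => (hS i).extClass.postcomp X (rfl : n + 1 = n + 1)) :=
      exact_piMap fun i => (ShortComplex.ab_exact_iff_function_exact _).mp
        (Ext.covariant_sequence_exact₃' X (hS i) n (n + 1) rfl)
    exact AddMonoidHom.bijective_of_surjective_of_bijective_of_right_exact
      ((Ext.mk₀ (piShortComplex S).g).postcomp X (add_zero n))
      (hT.extClass.postcomp X (rfl : n + 1 = n + 1))
      (AddMonoidHom.piMap fun i => (Ext.mk₀ (S i).g).postcomp X (add_zero n))
      (AddMonoidHom.piMap fun i => (hS i).extClass.postcomp X rfl)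
      (Ext.piComparison X (fun i => (S i).X₂) n) (Ext.piComparison X (fun i => (S i).X₃) n)
      (Ext.piComparison X (fun i => (S i).X₁) (n + 1))
      hc₁ hc₂ hf₁ hg₁ (hn _).2 (hn _)
      (fun x₁ => Ext.covariant_sequence_exact₁ _ hT x₁ (Ext.eq_zero_of_injective _) rfl)
      (Function.Surjective.piMap fun i x₁ =>
        Ext.covariant_sequence_exact₁ _ (hS i) x₁ (Ext.eq_zero_of_injective _) rfl)

omit [HasExt C] [EnoughInjectives C] in
/-- Mathlib's AB4* axiom for `ι`-indexed products (`HasExactLimitsOfShape (Discrete ι) C`: the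
product functor is exact) gives the epimorphism hypothesis: products of epimorphisms are
epimorphisms. [folklore] -/
theorem epi_piMap_of_hasExactLimitsOfShape [HasExactLimitsOfShape (Discrete ι) C] {A B : ι → C}
    (p : ∀ i, A i ⟶ B i) (hp : ∀ i, Epi (p i)) : Epi (Limits.Pi.map p) := by
  haveI : ∀ j, Epi ((Discrete.natTrans fun j : Discrete ι => p j.as :
      Discrete.functor A ⟶ Discrete.functor B).app j) := fun j => hp j.as
  haveI : Epi (Discrete.natTrans fun j : Discrete ι => p j.as :
      Discrete.functor A ⟶ Discrete.functor B) := NatTrans.epi_of_epi_app _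
  have h : Epi ((lim : (Discrete ι ⥤ C) ⥤ C).map
      (Discrete.natTrans fun j : Discrete ι => p j.as : Discrete.functor A ⟶ Discrete.functor B)) :=
    inferInstance
  rwa [lim_map] at h

/-- **`Ext(X, –)` commutes with `ι`-indexed products in an AB4* (for `ι`) abelian category with
enough injectives** (the form consumed through Mathlib's `HasExactLimitsOfShape (Discrete ι) C`,
e.g. `AB4Star`, `CountableAB4Star`). [cite: BhattScholze2015, Prop. 3.1.10 (proof)] -/
theorem Ext.piComparison_bijective_of_hasExactLimitsOfShape [HasExactLimitsOfShape (Discrete ι) C]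
    (X : C) (F : ι → C) (n : ℕ) : Function.Bijective (Ext.piComparison X F n) :=
  Ext.piComparison_bijective (fun _ _ p hp => epi_piMap_of_hasExactLimitsOfShape p hp) X F n

end Main

end Literature.Algebra.Homology
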